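import Summits.Ventures.GridStability.Lyapunov.RelativeLffNonUniformRefT
import HarnessLib

/-!
# GridStability/Lyapunov/RelativeLffNonUniformCert — generic NON-UNIFORM-damping LFF closed form,
# part 3: `Q ≻ 0`, a coercivity margin, and THE SOLVER-FREE CERTIFICATE for every lossless classical
# model with positive per-machine damping (any number of machines)

Venture GRIDFUSION, LFF lane, lead RULING R-LFF-NU-ROW (2026-08-27T06:44:49Z «generic statement
pending» — this file states it); seat gridfusion-lyap-1 (g5); namespace
`Summit.Ventures.GridStability.Lyapunov.RelativeLffNU`. Parts 1–2: `RelativeLffNonUniform.lean`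
(p522397: faces of (QKH) exact, `closedFormCert` from `X ⪰ 0` and `Q − ε1 ⪰ 0`),
`RelativeLffNonUniformRefT.lean` (`T = refT`: Sherman–Morrison `Ñ⁻¹`, `refTᵀÑ⁻¹refT = D − uuᵀ/ΣD`,
`X ⪰ 0` from the scalar test `h(M_i/D_i + τ) ≤ c′`, `τ²ΣD ≥ ΣM²/D`).

§7 `exists_posSemidef_sub_smul_one` — a real symmetric matrix with positive quadratic form off `0` has
a margin `Q − ε·1 ⪰ 0`, `ε > 0` (minimum on the compact set `{Σx_i² = 1}`); §8 `QOf_refT_quadForm` /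
`QOf_refT_pos` — the closed-form `Q`, square completed:
`xᵀQx = c′ΣM_iω_i² − h·zᵀÑ⁻¹z + h·(σ + z)ᵀÑ⁻¹(σ + z)`, `z = T·Λ⁻¹ω`, with `zᵀÑ⁻¹z ≤ Σ M_i²ω_i²/D_i` (§4)
and `Ñ⁻¹ ⪰ (D_0/ΣD)·diag(D′) ≻ 0` (`NinvD_quadForm_ge`), so **`Q ≻ 0` whenever `h·M_i/D_i < c′`**;
§9 **`exists_closedFormCert`: for machines `0..n`, ANY positive `M_i`, `D_i` (no uniform-damping
hypothesis), positive channel weights `w`, any line matrix `E`, equilibrium line angles `δ*`, and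
scalars `c′, h, τ > 0` with `Σ M_i²/D_i ≤ τ²·ΣD` and `h·(M_i/D_i + τ) ≤ c′` for every `i`, the closed
form `(Q, K = c′w, H = hw)` IS a member of Vu–Turitsyn's Lyapunov-functions family
[cite: VuTuritsyn2016, §III eq. (QKH)] on Pai's machine-reference system
`machineReference (D/M) refT (M⁻¹refTᵀEᵀW) E δ*` [cite: Pai1981, §3.6.3 eq. (3.45)]** — the LFF tier's
«uniform damping only» restriction (memo §3) is lifted for EVERY `n`, solver-free. The certified
region / synchronisation sentence is then lit-6's `machineReference_well_subset_regionOfAttraction_of_gapQ`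
(instances: rank-one facts + level by `decide`, as `WSCC9LffNonUniformRoa` p505678).

THREE COLUMNS. CERTIFIED (kernel): the theorem schema above about the MODEL CLASS = lossless
network-reduced classical multimachine model, per-machine damping `D_i > 0` (MV-2L; NO MV-λ), Pai's
machine-reference coordinates; CLASS = Vu–Turitsyn certificates. VALIDATED: nothing (no SDP, no
solver anywhere). No sentence of this file says that any grid is stable. No definitions, no named
fact; standard axioms.
-/

noncomputable section

open Real Set Filter Matrix Finset
open Literature.MathematicalPhysics.PowerSystems
open Literature.MathematicalPhysics.PowerSystems.LyapunovFunctionFamily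
open InternalNode (refT)

namespace Summit.Ventures.GridStability.Lyapunov.RelativeLffNU

variable {n : ℕ}

/-- A real matrix with `Pᵀ = P` and a non-negative quadratic form is positive semidefinite
(plumbing). -/
private theorem posSemidef_of_transpose_of_nonneg'' {m : Type*} [Fintype m] {P : Matrix m m ℝ}
    (hsymm : Pᵀ = P) (h : ∀ x : m → ℝ, 0 ≤ x ⬝ᵥ (P *ᵥ x)) : P.PosSemidef := by
  refine Matrix.PosSemidef.of_dotProduct_mulVec_nonneg ?_ fun x => ?_
  · rw [Matrix.IsHermitian, Matrix.conjTranspose_eq_transpose_of_trivial]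
    exact hsymm
  · rw [star_trivial]
    exact h x

/-! ### §7 Coercivity: a positive definite quadratic form has a margin `Q − ε1 ⪰ 0` -/

/-- **From positive definiteness to a coercivity margin** (compactness of the unit sphere): a real
symmetric matrix whose quadratic form is positive off the origin satisfies `Q − ε·1 ⪰ 0` for some
`ε > 0` (`ε` = the minimum of the form on `{Σ x_i² = 1}`). -/
theorem exists_posSemidef_sub_smul_one {m : Type*} [Fintype m] [DecidableEq m] {Q : Matrix m m ℝ}
    (hQt : Qᵀ = Q) (hpos : ∀ x : m → ℝ, x ≠ 0 → 0 < x ⬝ᵥ (Q *ᵥ x)) :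
    ∃ ε : ℝ, 0 < ε ∧ (Q - ε • (1 : Matrix m m ℝ)).PosSemidef := by
  -- the form and the «sphere» `K = {Σ x_i² = 1}`
  set f : (m → ℝ) → ℝ := fun x => x ⬝ᵥ (Q *ᵥ x) with hf
  have hfc : Continuous f := by
    have : f = fun x => ∑ i, x i * ∑ j, Q i j * x j := by
      funext x; simp [hf, dotProduct, Matrix.mulVec]
    rw [this]; fun_prop
  have hscale : ∀ (r : ℝ) (x : m → ℝ), f (r • x) = r ^ 2 * f x := by
    intro r x
    simp only [hf, Matrix.mulVec_smul, dotProduct_smul, smul_dotProduct, smul_eq_mul]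
    ring
  set K : Set (m → ℝ) := {x | ∑ i, x i ^ 2 = 1} with hK
  have hKc : IsCompact K := by
    refine Metric.isCompact_of_isClosed_isBounded ?_ ?_
    · exact isClosed_eq (by fun_prop) continuous_const
    · refine (Metric.isBounded_closedBall (x := (0 : m → ℝ)) (r := 1)).subset fun x hx => ?_
      rw [mem_closedBall_zero_iff, pi_norm_le_iff_of_nonneg zero_le_one]
      intro i
      rw [Real.norm_eq_abs, ← sq_le_one_iff_abs_le_one]
      have hx' : ∑ j, x j ^ 2 = 1 := hx
      rw [← hx']
      exact Finset.single_le_sum (fun j _ => sq_nonneg (x j)) (Finset.mem_univ i)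
  -- the key lower bound `ε·Σx² ≤ f x`
  have key : ∃ ε : ℝ, 0 < ε ∧ ∀ x : m → ℝ, ε * ∑ i, x i ^ 2 ≤ f x := by
    by_cases hKne : K.Nonempty
    · obtain ⟨x₀, hx₀K, hmin⟩ := hKc.exists_isMinOn hKne hfc.continuousOn
      have hx₀ : x₀ ≠ 0 := by
        intro h0
        have : ∑ i, x₀ i ^ 2 = 1 := hx₀K
        simp [h0] at this
      refine ⟨f x₀, hpos x₀ hx₀, fun x => ?_⟩
      by_cases hx : ∑ i, x i ^ 2 = 0
      · have hx0 : x = 0 := by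
          funext i
          have := (Finset.sum_eq_zero_iff_of_nonneg fun j _ => sq_nonneg (x j)).1 hx i (Finset.mem_univ i)
          exact pow_eq_zero_iff two_ne_zero |>.1 this
        subst hx0
        simp [hf]
      · have hr : 0 < ∑ i, x i ^ 2 :=
          lt_of_le_of_ne (Finset.sum_nonneg fun j _ => sq_nonneg (x j)) (Ne.symm hx)
        set r : ℝ := Real.sqrt (∑ i, x i ^ 2) with hr'
        have hr0 : 0 < r := Real.sqrt_pos.2 hr
        have hrr : r ^ 2 = ∑ i, x i ^ 2 := Real.sq_sqrt hr.le
        have hyK : r⁻¹ • x ∈ K := by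
          show ∑ i, (r⁻¹ • x) i ^ 2 = 1
          simp only [Pi.smul_apply, smul_eq_mul, mul_pow, ← Finset.mul_sum, ← hrr]
          field_simp
        have h1 : f x₀ ≤ f (r⁻¹ • x) := hmin hyK
        rw [hscale] at h1
        have h2 : f x₀ * r ^ 2 ≤ r⁻¹ ^ 2 * f x * r ^ 2 := mul_le_mul_of_nonneg_right h1 (sq_nonneg _)
        have h3 : r⁻¹ ^ 2 * f x * r ^ 2 = f x := by field_simp
        rw [h3, hrr] at h2
        exact h2
    · refine ⟨1, one_pos, fun x => ?_⟩
      -- `K = ∅` forces `m` empty, so every `x = 0`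
      have hx0 : ∀ i : m, False := fun i => hKne ⟨fun j => if j = i then 1 else 0, by
        show ∑ j, (fun j => if j = i then (1 : ℝ) else 0) j ^ 2 = 1
        simp [Finset.sum_ite_eq']⟩
      have : x = 0 := funext fun i => (hx0 i).elim
      subst this; simp [hf]
  obtain ⟨ε, hε, hεf⟩ := key
  refine ⟨ε, hε, posSemidef_of_transpose_of_nonneg'' ?_ fun x => ?_⟩
  · rw [Matrix.transpose_sub, Matrix.transpose_smul, Matrix.transpose_one, hQt]
  · have e : ∑ i, x i ^ 2 = x ⬝ᵥ x := by simp [dotProduct, pow_two]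
    have hx : x ⬝ᵥ ((Q - ε • (1 : Matrix m m ℝ)) *ᵥ x) = f x - ε * ∑ i, x i ^ 2 := by
      simp only [hf]
      rw [e, Matrix.sub_mulVec, dotProduct_sub, Matrix.smul_mulVec, Matrix.one_mulVec, dotProduct_smul,
        smul_eq_mul]
    rw [hx]
    linarith [hεf x]

/-! ### §8 The closed-form `Q` is positive definite when `h·M_i/D_i < c′` -/

/-- `z ⬝ Sum.elim a b = z∘inl ⬝ a + z∘inr ⬝ b` (plumbing). -/
private theorem dotProduct_sumElim' {m k : Type*} [Fintype m] [Fintype k] (z : m ⊕ k → ℝ)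
    (a : m → ℝ) (b : k → ℝ) :
    z ⬝ᵥ Sum.elim a b = (z ∘ Sum.inl) ⬝ᵥ a + (z ∘ Sum.inr) ⬝ᵥ b := by
  simp [dotProduct, Fintype.sum_sum_type]

/-- `(abᵀ)·v = (b·v)·a` (plumbing). -/
private theorem vecMulVec_mulVec' {m k : Type*} [Fintype k] (a : m → ℝ) (b : k → ℝ)
    (v : k → ℝ) : Matrix.vecMulVec a b *ᵥ v = (b ⬝ᵥ v) • a := by
  funext i
  simp only [Matrix.mulVec, dotProduct, Matrix.vecMulVec_apply, Pi.smul_apply, smul_eq_mul]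
  rw [mul_comm, Finset.mul_sum]
  exact Finset.sum_congr rfl fun j _ => by ring

/-- `diag(v)·w` as a function (plumbing). -/
private theorem diagonal_mulVec' {m : Type*} [Fintype m] [DecidableEq m] (v w : m → ℝ) :
    Matrix.diagonal v *ᵥ w = fun i => v i * w i :=
  funext fun i => Matrix.mulVec_diagonal v w i

/-- `vᵀ·diag(D)·v = Σ D_iv_i²` (plumbing). -/
private theorem dotProduct_diagonal_mulVec' {m : Type*} [Fintype m] [DecidableEq m] (D v : m → ℝ) :
    v ⬝ᵥ (Matrix.diagonal D *ᵥ v) = ∑ i, D i * v i ^ 2 := by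
  simp only [dotProduct, diagonal_mulVec']
  exact Finset.sum_congr rfl fun i _ => by ring

/-- For a symmetric real matrix, `a ⬝ N b = b ⬝ N a` (plumbing). -/
private theorem dotProduct_mulVec_comm' {m : Type*} [Fintype m] {N : Matrix m m ℝ} (hN : Nᵀ = N)
    (a b : m → ℝ) : a ⬝ᵥ (N *ᵥ b) = b ⬝ᵥ (N *ᵥ a) := by
  rw [Matrix.dotProduct_mulVec, ← Matrix.mulVec_transpose, hN, dotProduct_comm]

/-- **The quadratic form of `refTᵀÑ⁻¹refT`**: `(Tv)ᵀÑ⁻¹(Tv) = Σ D_iv_i² − (Σ D_iv_i)²/ΣD`. -/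
theorem refT_NinvD_quadForm (D : Fin (n + 1) → ℝ) (hS : Dsum D ≠ 0) (v : Fin (n + 1) → ℝ) :
    (refT n *ᵥ v) ⬝ᵥ (NinvD D *ᵥ (refT n *ᵥ v))
      = ∑ i, D i * v i ^ 2 - 1 / Dsum D * (∑ i, D i * v i) ^ 2 := by
  rw [Matrix.mulVec_mulVec, ← Matrix.vecMul_transpose, ← Matrix.dotProduct_mulVec, Matrix.mulVec_mulVec,
    ← Matrix.mul_assoc, Matrix.mul_assoc, refT_transpose_mul_NinvD_mul_refT D hS, Matrix.sub_mulVec,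
    dotProduct_sub, Matrix.smul_mulVec, vecMulVec_mulVec', dotProduct_smul, dotProduct_smul,
    dotProduct_diagonal_mulVec', dotProduct_comm v D]
  simp only [dotProduct, smul_eq_mul, pow_two]

/-- **`Ñ⁻¹` is positive definite**, quantitatively: `yᵀÑ⁻¹y ≥ (D_0/ΣD)·Σ_a D′_a y_a²`
(weighted Cauchy–Schwarz, `ΣD′ = ΣD − D_0`). -/
theorem NinvD_quadForm_ge (D : Fin (n + 1) → ℝ) (hD : ∀ i, 0 < D i) (y : Fin n → ℝ) :
    D 0 / Dsum D * ∑ a, D a.succ * y a ^ 2 ≤ y ⬝ᵥ (NinvD D *ᵥ y) := by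
  have hS : 0 < Dsum D := Finset.sum_pos (fun i _ => hD i) Finset.univ_nonempty
  have hq : y ⬝ᵥ (NinvD D *ᵥ y) = ∑ a, D a.succ * y a ^ 2 - 1 / Dsum D * (∑ a, D a.succ * y a) ^ 2 := by
    rw [NinvD, Matrix.sub_mulVec, dotProduct_sub, Matrix.smul_mulVec, vecMulVec_mulVec', dotProduct_smul,
      dotProduct_smul, dotProduct_diagonal_mulVec', dotProduct_comm y]
    simp only [dotProduct, smul_eq_mul, pow_two]
  rw [hq]
  -- `(Σ D′y)² ≤ (ΣD′)(ΣD′y²)` and `ΣD′ = ΣD − D_0`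
  have hcs := Finset.sum_mul_sq_le_sq_mul_sq Finset.univ (fun a : Fin n => Real.sqrt (D a.succ))
    (fun a => Real.sqrt (D a.succ) * y a)
  have e1 : ∀ a : Fin n, Real.sqrt (D a.succ) * (Real.sqrt (D a.succ) * y a) = D a.succ * y a := fun a => by
    rw [← mul_assoc, Real.mul_self_sqrt (hD a.succ).le]
  have e2 : ∀ a : Fin n, Real.sqrt (D a.succ) ^ 2 = D a.succ := fun a => Real.sq_sqrt (hD a.succ).le
  have e3 : ∀ a : Fin n, (Real.sqrt (D a.succ) * y a) ^ 2 = D a.succ * y a ^ 2 := fun a => by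
    rw [mul_pow, Real.sq_sqrt (hD a.succ).le]
  simp only [e1, e2, e3] at hcs
  have hP : 0 ≤ ∑ a, D a.succ * y a ^ 2 := Finset.sum_nonneg fun a _ => mul_nonneg (hD a.succ).le (sq_nonneg _)
  have hsum : ∑ a : Fin n, D a.succ = Dsum D - D 0 := by rw [Dsum_eq]; ring
  rw [hsum] at hcs
  have h1 : 1 / Dsum D * (∑ a, D a.succ * y a) ^ 2 ≤ 1 / Dsum D * ((Dsum D - D 0) * ∑ a, D a.succ * y a ^ 2) :=
    mul_le_mul_of_nonneg_left hcs (by positivity)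
  have e4 : D 0 / Dsum D * ∑ a, D a.succ * y a ^ 2
      = ∑ a, D a.succ * y a ^ 2 - 1 / Dsum D * ((Dsum D - D 0) * ∑ a, D a.succ * y a ^ 2) := by
    field_simp
    ring
  rw [e4]
  linarith

/-- **The quadratic form of the closed-form `Q`, square completed** (`T = refT`): with
`z = T·Λ⁻¹ω` (`Λ⁻¹ω = (M_iω_i/D_i)_i`),
`xᵀQx = c′Σ M_iω_i² − h·zᵀÑ⁻¹z + h·(σ + z)ᵀÑ⁻¹(σ + z)`. -/
theorem QOf_refT_quadForm (M D : Fin (n + 1) → ℝ) (c' h : ℝ) (x : Fin (n + 1) ⊕ Fin n → ℝ) :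
    x ⬝ᵥ (QOf M D (refT n) (NinvD D) c' h *ᵥ x)
      = c' * ∑ i, M i * (x (Sum.inl i)) ^ 2
        - h * ((refT n *ᵥ fun i => M i / D i * x (Sum.inl i)) ⬝ᵥ
            (NinvD D *ᵥ (refT n *ᵥ fun i => M i / D i * x (Sum.inl i))))
        + h * (((x ∘ Sum.inr) + refT n *ᵥ fun i => M i / D i * x (Sum.inl i)) ⬝ᵥ
            (NinvD D *ᵥ ((x ∘ Sum.inr) + refT n *ᵥ fun i => M i / D i * x (Sum.inl i)))) := by
  set ω : Fin (n + 1) → ℝ := x ∘ Sum.inl with hω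
  set σ : Fin n → ℝ := x ∘ Sum.inr with hσ
  set z : Fin n → ℝ := refT n *ᵥ fun i => M i / D i * x (Sum.inl i) with hz
  have hNt := NinvD_transpose D
  -- the blocks
  have hQ21 : Q₂₁ M D (refT n) (NinvD D) h *ᵥ ω = h • (NinvD D *ᵥ z) := by
    rw [Q₂₁, Matrix.smul_mulVec, ← Matrix.mulVec_mulVec, ← Matrix.mulVec_mulVec, diagonal_mulVec']
    rfl
  have h11 : ω ⬝ᵥ (Q₁₁ M c' *ᵥ ω) = c' * ∑ i, M i * (x (Sum.inl i)) ^ 2 := by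
    rw [Q₁₁, Matrix.smul_mulVec, dotProduct_smul, smul_eq_mul, dotProduct_diagonal_mulVec']
    rfl
  have h12 : ω ⬝ᵥ ((Q₂₁ M D (refT n) (NinvD D) h)ᵀ *ᵥ σ) = h * (σ ⬝ᵥ (NinvD D *ᵥ z)) := by
    rw [Matrix.mulVec_transpose, dotProduct_comm, ← Matrix.dotProduct_mulVec, hQ21, dotProduct_smul,
      smul_eq_mul]
  have h21 : σ ⬝ᵥ (Q₂₁ M D (refT n) (NinvD D) h *ᵥ ω) = h * (σ ⬝ᵥ (NinvD D *ᵥ z)) := by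
    rw [hQ21, dotProduct_smul, smul_eq_mul]
  have h22 : σ ⬝ᵥ (Q₂₂ (NinvD D) h *ᵥ σ) = h * (σ ⬝ᵥ (NinvD D *ᵥ σ)) := by
    rw [Q₂₂, Matrix.smul_mulVec, dotProduct_smul, smul_eq_mul]
  -- square completion
  have hsq : (σ + z) ⬝ᵥ (NinvD D *ᵥ (σ + z))
      = σ ⬝ᵥ (NinvD D *ᵥ σ) + 2 * (σ ⬝ᵥ (NinvD D *ᵥ z)) + z ⬝ᵥ (NinvD D *ᵥ z) := by
    rw [Matrix.mulVec_add, add_dotProduct, dotProduct_add, dotProduct_add,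
      dotProduct_mulVec_comm' hNt z σ]
    ring
  rw [QOf, Matrix.fromBlocks_mulVec, dotProduct_sumElim', dotProduct_add, dotProduct_add, ← hω, ← hσ, h11,
    h12, h21, h22, hsq]
  ring

/-- **The closed-form `Q` is POSITIVE DEFINITE** whenever `h·M_i/D_i < c′` for every machine
(`M, D, h > 0`): `xᵀQx ≥ Σ M_i(c′ − hM_i/D_i)ω_i² + h·(σ + z)ᵀÑ⁻¹(σ + z)` and `Ñ⁻¹ ≻ 0`. -/
theorem QOf_refT_pos (M D : Fin (n + 1) → ℝ) (c' h : ℝ) (hM : ∀ i, 0 < M i) (hD : ∀ i, 0 < D i)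
    (hh : 0 < h) (hc : ∀ i, h * M i / D i < c') (x : Fin (n + 1) ⊕ Fin n → ℝ) (hx : x ≠ 0) :
    0 < x ⬝ᵥ (QOf M D (refT n) (NinvD D) c' h *ᵥ x) := by
  have hS : 0 < Dsum D := Finset.sum_pos (fun i _ => hD i) Finset.univ_nonempty
  rw [QOf_refT_quadForm]
  set v : Fin (n + 1) → ℝ := fun i => M i / D i * x (Sum.inl i) with hv
  set z : Fin n → ℝ := refT n *ᵥ v with hz
  set y : Fin n → ℝ := (x ∘ Sum.inr) + z with hy
  have hzle : z ⬝ᵥ (NinvD D *ᵥ z) ≤ ∑ i, D i * v i ^ 2 := by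
    rw [hz, refT_NinvD_quadForm D hS.ne' v]
    have : 0 ≤ 1 / Dsum D * (∑ i, D i * v i) ^ 2 := by positivity
    linarith
  have hyge : 0 ≤ y ⬝ᵥ (NinvD D *ᵥ y) :=
    le_trans (mul_nonneg (div_nonneg (hD 0).le hS.le)
      (Finset.sum_nonneg fun a _ => mul_nonneg (hD a.succ).le (sq_nonneg _))) (NinvD_quadForm_ge D hD y)
  have hDv : ∑ i, D i * v i ^ 2 = ∑ i, M i ^ 2 / D i * x (Sum.inl i) ^ 2 := by
    refine Finset.sum_congr rfl fun i _ => ?_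
    simp only [hv]
    field_simp [(hD i).ne']
  have hcoef : ∀ i, 0 < c' * M i - h * (M i ^ 2 / D i) := by
    intro i
    have h1 : h * M i / D i < c' := hc i
    have hMi := hM i
    have hDi := hD i
    have e : h * (M i ^ 2 / D i) = (h * M i / D i) * M i := by
      field_simp
    rw [e]
    nlinarith
  by_cases hω : ∀ i, x (Sum.inl i) = 0
  · -- all speeds vanish: `z = 0`, `y = σ ≠ 0`, and `Ñ⁻¹ ≻ 0`
    have hv0 : v = 0 := by funext i; simp [hv, hω i]
    have hz0 : z = 0 := by rw [hz, hv0, Matrix.mulVec_zero]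
    have hσ : ∃ a, x (Sum.inr a) ≠ 0 := by
      by_contra hcon
      push Not at hcon
      exact hx (funext fun j => by rcases j with i | a <;> [exact hω i; exact hcon a])
    obtain ⟨a, ha⟩ := hσ
    have hya : y a = x (Sum.inr a) := by simp [hy, hz0]
    have hypos : 0 < y ⬝ᵥ (NinvD D *ᵥ y) := by
      refine lt_of_lt_of_le (mul_pos (div_pos (hD 0) hS) ?_) (NinvD_quadForm_ge D hD y)
      refine lt_of_lt_of_le ?_ (Finset.single_le_sum
        (fun b _ => mul_nonneg (hD (Fin.succ b)).le (sq_nonneg (y b))) (Finset.mem_univ a))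
      rw [hya]
      exact mul_pos (hD a.succ) (by positivity)
    have hω0 : ∑ i, M i * x (Sum.inl i) ^ 2 = 0 := Finset.sum_eq_zero fun i _ => by simp [hω i]
    have hzz : z ⬝ᵥ (NinvD D *ᵥ z) = 0 := by simp [hz0]
    rw [hω0, hzz]
    nlinarith [mul_pos hh hypos]
  · -- some speed is non-zero: the diagonal term is positive
    push Not at hω
    obtain ⟨i₀, hi₀⟩ := hω
    have hsum : h * ∑ i, D i * v i ^ 2 < c' * ∑ i, M i * x (Sum.inl i) ^ 2 := by
      rw [hDv, Finset.mul_sum, Finset.mul_sum, ← sub_pos, ← Finset.sum_sub_distrib]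
      have hterm : ∀ i, 0 ≤ c' * (M i * x (Sum.inl i) ^ 2) - h * (M i ^ 2 / D i * x (Sum.inl i) ^ 2) := by
        intro i
        have e : c' * (M i * x (Sum.inl i) ^ 2) - h * (M i ^ 2 / D i * x (Sum.inl i) ^ 2)
            = (c' * M i - h * (M i ^ 2 / D i)) * x (Sum.inl i) ^ 2 := by ring
        rw [e]; exact mul_nonneg (hcoef i).le (sq_nonneg _)
      refine lt_of_lt_of_le ?_ (Finset.single_le_sum (fun i _ => hterm i) (Finset.mem_univ i₀))
      have e : c' * (M i₀ * x (Sum.inl i₀) ^ 2) - h * (M i₀ ^ 2 / D i₀ * x (Sum.inl i₀) ^ 2)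
          = (c' * M i₀ - h * (M i₀ ^ 2 / D i₀)) * x (Sum.inl i₀) ^ 2 := by ring
      rw [e]
      exact mul_pos (hcoef i₀) (by positivity)
    have h1 : h * (z ⬝ᵥ (NinvD D *ᵥ z)) ≤ h * ∑ i, D i * v i ^ 2 := mul_le_mul_of_nonneg_left hzle hh.le
    have h2 : 0 ≤ h * (y ⬝ᵥ (NinvD D *ᵥ y)) := mul_nonneg hh.le hyge
    linarith

/-- The closed-form `Q` is symmetric (for symmetric `Ñ⁻¹`). -/
theorem QOf_transpose {ν μ : Type*} [Fintype ν] [Fintype μ] [DecidableEq ν] (M D : ν → ℝ)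
    (T : Matrix μ ν ℝ)
    {Ninv : Matrix μ μ ℝ} (hNt : Ninvᵀ = Ninv) (c' h : ℝ) :
    (QOf M D T Ninv c' h)ᵀ = QOf M D T Ninv c' h := by
  rw [QOf, Matrix.fromBlocks_transpose, Matrix.transpose_transpose, Q₁₁_transpose, Q₂₂_transpose hNt]

/-! ### §9 THE SOLVER-FREE CERTIFICATE for every lossless model with positive per-machine damping -/

/-- **A Vu–Turitsyn certificate for EVERY lossless classical model with NON-UNIFORM damping, from
SCALAR inequalities only.** Machines `0..n` (reference `0`), ANY positive inertias `M_i`, dampings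
`D_i`, positive channel weights `w`, ANY line matrix `E` and equilibrium line angles `δ*`; parameters
`c′, h, τ > 0` with `Σ_i M_i²/D_i ≤ τ²·ΣD` and `h·(M_i/D_i + τ) ≤ c′` for every machine (e.g.
`τ² = (Σ M²/D)/ΣD` rounded up, `h = c′/(max_i M_i/D_i + τ)`): then the closed form
`Q = [[c′M, hΛ⁻¹TᵀÑ⁻¹], [hÑ⁻¹TΛ⁻¹, hÑ⁻¹]]`, `K = c′w`, `H = hw` (with SOME coercivity margin `ε > 0`)
is a member of the Lyapunov-functions family on Pai's machine-reference space
`sysOf M D refT E w δ* = machineReference (D/M) refT (M⁻¹refTᵀEᵀW) E δ*` — no semidefinite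
programming, no uniform-damping hypothesis, every `n`. (The region / synchronisation sentence is
then lit-6's `machineReference_well_subset_regionOfAttraction_of_gapQ`; sequel part 3.)
[cite: VuTuritsyn2016, §III eq. (QKH); Pai1981, §3.6.3 eq. (3.45)] -/
theorem exists_closedFormCert {κ : Type*} [Fintype κ] [DecidableEq κ] (M D : Fin (n + 1) → ℝ)
    (E : Matrix κ (Fin n) ℝ) (w : κ → ℝ) (δs : κ → ℝ) (c' h : ℝ) (hM : ∀ i, 0 < M i)
    (hD : ∀ i, 0 < D i) (hw : ∀ k, 0 < w k) (hc' : 0 < c') (hh : 0 < h) {τ : ℝ} (hτ : 0 < τ)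
    (hτ2 : ∑ i, M i ^ 2 / D i ≤ τ ^ 2 * Dsum D) (hcond : ∀ i, h * (M i / D i + τ) ≤ c') :
    ∃ Λ : Certificate (sysOf M D (refT n) E w δs),
      Λ.Q = QOf M D (refT n) (NinvD D) c' h ∧ Λ.kK = (fun k => c' * w k) ∧ Λ.h = (fun k => h * w k) := by
  have hc : ∀ i, h * M i / D i < c' := fun i => by
    have h1 := hcond i
    have e : h * M i / D i = h * (M i / D i + τ) - h * τ := by ring
    rw [e]
    nlinarith [mul_pos hh hτ]
  obtain ⟨ε, hε, hQ⟩ := exists_posSemidef_sub_smul_one (QOf_transpose M D (refT n) (NinvD_transpose D) c' h)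
    (QOf_refT_pos M D c' h hM hD hh hc)
  exact ⟨closedFormCert M D (refT n) E w δs (NinvD D) c' h ε hM hD hw hc' hh hε (NinvD_transpose D)
    (NinvD_mul D hD) (XOf_refT_posSemidef M D c' h hM hD hh.le hτ.le hτ2 hcond) hQ, rfl, rfl, rfl⟩

end Summit.Ventures.GridStability.Lyapunov.RelativeLffNU

end
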